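import Summits.Ventures.PercRepro.Night2TwoFatCellsB
import Summits.Ventures.PercRepro.Night2TwoFatCellsC

/-!
# PercRepro — the `(7, 5)` shadow row modulo the residues H = F + G (night-2, gen 23)

`Night2TwoFatCellsB` closes the cells `(3, 0)` at `|G| = 13` and `(3, 1)` at `|G| = 17` whenever two thin members
missing `≤ 2` resp. `≤ 3` points have NON-NESTED missed sets (residues F: the clause `NestedFat N G 2 3` at those two
sizes), and `Night2TwoFatCellsC` closes `(3, 1)` at `|G| = 16` whenever two thin members missing `≤ 2` points have
DISJOINT missed sets (residues G, stated over residues E: the clause `MeetingFat N G 2` at `|G| = 16`).  The two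
modules were landed independently (C on E, because B's olean lagged on the farm); this file composes them:
**`shadowHall_seven_five_of_residuesH`** — the `(7, 5)` shadow row for every finite matroid modulo the residues of D
with `NestedFat N G 2 3` at `(3, 0)`, `|G| = 13` and `(3, 1)`, `|G| = 17`, AND `MeetingFat N G 2` at `(3, 1)`,
`|G| = 16` (residues H ⊂ F ⊂ E ⊂ D).
-/

namespace PercRepro.Shadow

open Finset PerFlat ThmH

section SevenFiveH

variable {α' : Type} [DecidableEq α']

/-- **THE `(7, 5)` SHADOW ROW FOR EVERY FINITE MATROID MODULO THE RESIDUES H**: the residues of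
`shadowHall_seven_five_of_residuesF` (`NestedFat N G 2 3` at `(3, 0)`, `|G| = 13` and at `(3, 1)`, `|G| = 17`) with,
at `(3, 1)`, `|G| = 16`, the extra clause `MeetingFat N G 2` of `shadowHall_seven_five_of_residuesG`. -/
theorem shadowHall_seven_five_of_residuesH
    (h20 : ∀ (N : Matroid α') [N.Finite] (G : Finset α'), CellHyp N G →
      (gr N \ G).card = 2 → kColoops N G = 0 → FatMember N G 6 3 →
      (FatBasis N G 6 2 ∨ FatMember N G 6 2) → LocalShadowHall N 5 G)
    (h21 : ∀ (N : Matroid α') [N.Finite] (G : Finset α'), CellHyp N G →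
      (gr N \ G).card = 2 → kColoops N G = 1 → FatMember N G 5 4 →
      (FatBasis N G 5 3 ∨ FatMember N G 5 3) → LocalShadowHall N 5 G)
    (h30 : ∀ (N : Matroid α') [N.Finite] (G : Finset α'), CellHyp N G →
      (gr N \ G).card = 3 → kColoops N G = 0 → 10 ≤ G.card → G.card ≤ 13 → FatMember N G 6 2 →
      FatBasis N G 6 2 → (G.card = 13 → NestedFat N G 2 3) → LocalShadowHall N 5 G)
    (h31 : ∀ (N : Matroid α') [N.Finite] (G : Finset α'), CellHyp N G →
      (gr N \ G).card = 3 → kColoops N G = 1 → 11 ≤ G.card → G.card ≤ 17 → FatMember N G 5 2 →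
      (G.card = 17 → FatBasis N G 5 2) → (G.card = 17 → NestedFat N G 2 3) →
      (G.card = 16 → MeetingFat N G 2) →
      (G.card = 11 ∨ G.card = 15 ∨ G.card = 16 → FatBasis N G 5 3) →
      (12 ≤ G.card ∧ G.card ≤ 14 → FatBasis N G 5 4) → LocalShadowHall N 5 G)
    (h32 : ∀ (N : Matroid α') [N.Finite] (G : Finset α'), CellHyp N G →
      (gr N \ G).card = 3 → kColoops N G = 2 → FatMember N G 4 2 → LocalShadowHall N 5 G)
    (M : Matroid α') [M.Finite] : ShadowHall M 7 5 (phiK 7 5) := by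
  apply shadowHall_seven_five_of_residuesF h20 h21 h30 _ h32
  intro N _ G hcell hd hk h11 h17 hfm hb2 hnest hb3 hb4
  by_cases hmeet : MeetingFat N G 2
  · exact h31 N G hcell hd hk h11 h17 hfm hb2 hnest (fun _ => hmeet) hb3 hb4
  · by_cases hG16 : G.card = 16
    · unfold MeetingFat at hmeet
      push Not at hmeet
      obtain ⟨B₀, hB₀, B₁, hB₁, hf₀, hf₁, hdis⟩ := hmeet
      exact localShadowHall_three_one_five_sixteen_of_disjoint hcell.2.2.2 hd hk hcell.1 hcell.2.1 hG16
        hB₀ hB₁ hf₀ hf₁ hdis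
    · exact h31 N G hcell hd hk h11 h17 hfm hb2 hnest (fun h => absurd h hG16) hb3 hb4

end SevenFiveH

end PercRepro.Shadow
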